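import Mathlib
import Summits.Ventures.HodgeRepro2.T5ProfiniteCharacterExtension
import Summits.Ventures.HodgeRepro2.T5CompactCharacterUnitary

/-!
# (A8b) as worded: `ℂˣ`-valued continuous characters of closed subgroups of profinite abelian
groups extend (kernel witness, assembled from `T5ProfiniteCharacterExtension` and
`T5CompactCharacterUnitary`)

The [A]-ledger states «(A8b) characters of a closed subgroup of a compact abelian group extend to
the group»; its characters take values in `ℂˣ`.  For a PROFINITE (compact, totally disconnected)
abelian group `G` — the case in use — this file proves exactly that wording:

* `exists_continuous_extension_units_of_isClosed` — `H ≤ G` closed, `φ : H →* ℂˣ` continuous ⇒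
  there is a continuous `φ' : G →* ℂˣ` with `φ'|_H = φ`, and `φ'` is unitary;
* `exists_continuous_extension_units` — the same for ANY subgroup `H`, provided `φ` is unitary
  (closedness of `H` is used only to know that `φ` is unitary, `T5CompactCharacterUnitary`).

Proof: `φ` is unitary on the compact group `H` (`norm_eq_one_of_isClosed`), so it is a continuous
`H →* Circle` (`toCircle`); the profinite extension theorem
(`exists_continuous_extension_circle_of_profinite`) extends it continuously to `G →* Circle`;
composing with the continuous `Circle.toUnits` gives `φ'`.
Imports: Mathlib + two accepted files of this prefix; axioms standard.
Uses an L-value-free non-vanishing device: NO (README §8(d)).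
-/

namespace Summit.Ventures.HodgeRepro2.T5ProfiniteCharacterExtensionUnits

open Summit.Ventures.HodgeRepro2.T5ProfiniteCharacterExtension
open Summit.Ventures.HodgeRepro2.T5CompactCharacterUnitary

variable {G : Type*} [CommGroup G] [TopologicalSpace G] [IsTopologicalGroup G] [CompactSpace G]
  [TotallyDisconnectedSpace G]

/-- **(A8b), unitary input.** `G` profinite abelian, `H ≤ G` ANY subgroup, `φ : H →* ℂˣ`
continuous and unitary ⇒ a continuous unitary `φ' : G →* ℂˣ` extends `φ`. -/
theorem exists_continuous_extension_units (H : Subgroup G) (φ : H →* ℂˣ) (hφ : Continuous φ)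
    (hunit : ∀ h : H, ‖(φ h : ℂ)‖ = 1) :
    ∃ φ' : G →* ℂˣ, Continuous φ' ∧ (∀ h : H, φ' h = φ h) ∧ ∀ g : G, ‖(φ' g : ℂ)‖ = 1 := by
  obtain ⟨χ', hc, hext⟩ :=
    exists_continuous_extension_circle_of_profinite H (toCircle φ hunit)
      (continuous_toCircle φ hunit hφ)
  refine ⟨Circle.toUnits.comp χ', continuous_toUnits_comp χ' hc, fun h => ?_, fun g => ?_⟩
  · apply Units.ext
    simp [hext h]
  · simp

/-- **(A8b) as worded.** `G` profinite abelian, `H ≤ G` CLOSED, `φ : H →* ℂˣ` continuous ⇒ a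
continuous (unitary) `φ' : G →* ℂˣ` extends `φ`. -/
theorem exists_continuous_extension_units_of_isClosed (H : Subgroup G)
    (hH : IsClosed (H : Set G)) (φ : H →* ℂˣ) (hφ : Continuous φ) :
    ∃ φ' : G →* ℂˣ, Continuous φ' ∧ (∀ h : H, φ' h = φ h) ∧ ∀ g : G, ‖(φ' g : ℂ)‖ = 1 :=
  exists_continuous_extension_units H φ hφ (norm_eq_one_of_isClosed H hH φ hφ)

end Summit.Ventures.HodgeRepro2.T5ProfiniteCharacterExtensionUnits
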